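import Summits.ABC.ABC.Theorems.IsogenyGlueCongruencePolyDegreeOfBoundedPrimesHeightCalibration
import Summits.ABC.ABC.Theorems.IsogenyGlueCongruenceSemistableHeightPolyBound
import Literature.NumberTheory.EllipticCurves.ModularCurveNeronLatticeProofs
import Literature.NumberTheory.DiophantineGeometry.FaltingsHeight

/-!
# Crux B (`PolyDegreeOfBoundedPrimes`, stmt-ABC-2046): the residual `H` in Faltings-height form

The open content of crux B of route IsogenyGlueCongruence is the polynomial HEIGHT conjecture for semistable curves,

  `H : ∃ σ C, ∀ W/ℚ elliptic, globally minimal, semistable, max(|Δ_W|, |c₄(W)|³) ≤ C · N_W^σ`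

(`polyDegreeOfBoundedPrimes_iff_polyHeight_of_mazurKenku`: `B ↔ (A → H)` modulo Edixhoven, Česnavičius and the
route item `MazurKenkuBound`). This file restates `H` in the height vocabulary of the route (Faltings height
`h(E/ℚ) = W.faltingsHeight`, stable Faltings height `h_F = W.stableFaltingsHeight`, the quantities of the route
items `EllipticGluingPrimeBound`, `SemistableHeightPolyBound` and of Pasten's theorem `h(E) < (1/48 + ε) N log N`):

* `faltingsHeight_le_log_iff_polyHeight` : `H ↔ ∃ a b, ∀ W (same class), h(E/ℚ) ≤ a · log N_W + b` —
  the LOGARITHMIC Faltings-height bound; unconditional, both directions by Silverman's comparison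
  `h(E/ℚ) = −½ log covol(Λ_E)` with `max(|Δ|, |c₄|³)` (Silverman 1986, Prop. 1.1, Cor. 2.3; tree theorems
  `covolume_rpow_neg_six_le_of_isNeronLatticeOf`, `silverman1986_discriminant_c4_covolume_holds`,
  `faltingsHeight_eq_neg_half_log_covolume`, `exists_isNeronLatticeOf_holds`);
* `stableFaltingsHeight_le_log_of_polyHeight` : `H →` the same bound for `h_F ≤ h(E/ℚ)`.

So crux B asks, granted crux A, for `h(E) ≪ log N_E` on semistable curves, where `h(E) ≪ N log N` is what is known
(PastenShimura2024 Thm 1.9, MurtyPasten2013) and `h_F ≤ c·N²` is the route's item `SemistableHeightPolyBound`: the gap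
is a logarithm, i.e. Szpiro strength. No definition, no new named fact; supports stmt-ABC-2046.

References: J. H. Silverman, *Heights and elliptic curves*, in Arithmetic Geometry (1986), Prop. 1.1, Cor. 2.3;
H. Pasten, *Shimura curves and the abc conjecture*, J. Number Theory 254 (2024), §3, Thm 1.9; G. Frey, *Links between
solutions of A − B = C and elliptic curves* (1989).
-/

noncomputable section

-- single-conjunct summit ABC: the duplicate ABC.ABC is mandated (CONVENTIONS §2)
set_option linter.dupNamespace false

namespace Summit.ABC.ABC.Theorems

open Literature.NumberTheory.EllipticCurves Literature.NumberTheory.EllipticCurves.ModularForms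
open Summit.ABC.ABC.Theses.IsogenyGlueCongruence

/-- **`H →` logarithmic Faltings height.** If `max(|Δ_W|, |c₄(W)|³) ≤ C·N^σ` for every semistable globally
minimal elliptic `W/ℚ`, then `h(E/ℚ) ≤ (max σ 0 / 12) · log N + b` for all such `W`: with a Néron lattice `Λ` of `W`,
`h = −½ log covol(Λ)` and Silverman's `covol(Λ)^{−6} ≤ A · max(|c₄|³, |c₆|²) ≤ 1729 A · max(|Δ|, |c₄|³)`.
[cite: Silverman1986, Prop. 1.1 and Cor. 2.3] -/
theorem faltingsHeight_le_log_of_polyHeight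
    (hH : ∃ σ C : ℝ, ∀ (W : WeierstrassCurve ℚ) [W.IsElliptic] [W.IsGloballyMinimal]
      [NeZero (W.conductorNorm ℤ)], W.IsSemistable ℤ →
      ((max |W.Δ| (|W.c₄| ^ 3) : ℚ) : ℝ) ≤ C * (W.conductorNorm ℤ : ℝ) ^ σ) :
    ∃ a b : ℝ, ∀ (W : WeierstrassCurve ℚ) [W.IsElliptic] [W.IsGloballyMinimal]
      [NeZero (W.conductorNorm ℤ)], W.IsSemistable ℤ →
      W.faltingsHeight ≤ a * Real.log (W.conductorNorm ℤ) + b := by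
  obtain ⟨σ, CH, hH⟩ := hH
  obtain ⟨A, hA, hSil⟩ := covolume_rpow_neg_six_le_of_isNeronLatticeOf
  set B : ℝ := A * (1729 * max CH 1) with hB
  have hB0 : 0 < B := by positivity
  refine ⟨max σ 0 / 12, Real.log B / 12, fun W _ _ _ hss ↦ ?_⟩
  set N : ℕ := W.conductorNorm ℤ with hNdef
  have hNpos : (0 : ℝ) < N := by exact_mod_cast Nat.pos_of_ne_zero (NeZero.ne N)
  have hN1 : (1 : ℝ) ≤ N := by exact_mod_cast Nat.pos_of_ne_zero (NeZero.ne N)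
  obtain ⟨L, hL⟩ := exists_isNeronLatticeOf_holds (W.baseChange ℂ)
  have hcov : 0 < ZLattice.covolume L.lattice := ZLattice.covolume_pos _ _
  rw [W.faltingsHeight_eq_neg_half_log_covolume hL]
  -- `max(|c₄|³,|c₆|²) ≤ 1729 · max(|Δ|,|c₄|³) ≤ 1729 · max CH 1 · N^{max σ 0}`
  have hmax : ((max (|W.c₄| ^ 3) (|W.c₆| ^ 2) : ℚ) : ℝ) ≤
      1729 * max CH 1 * (N : ℝ) ^ (max σ 0) := by
    have h1 : ((max (|W.c₄| ^ 3) (|W.c₆| ^ 2) : ℚ) : ℝ) ≤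
        ((1729 * max |W.Δ| (|W.c₄| ^ 3) : ℚ) : ℝ) := by
      exact_mod_cast HeightCalibration.max_abs_c₄_c₆_le_rat W
    have hNσ : (N : ℝ) ^ σ ≤ (N : ℝ) ^ (max σ 0) :=
      Real.rpow_le_rpow_of_exponent_le hN1 (le_max_left _ _)
    have h2 : ((max |W.Δ| (|W.c₄| ^ 3) : ℚ) : ℝ) ≤ max CH 1 * (N : ℝ) ^ (max σ 0) :=
      calc ((max |W.Δ| (|W.c₄| ^ 3) : ℚ) : ℝ) ≤ CH * (N : ℝ) ^ σ := hH W hss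
        _ ≤ max CH 1 * (N : ℝ) ^ σ := mul_le_mul_of_nonneg_right (le_max_left _ _) (by positivity)
        _ ≤ max CH 1 * (N : ℝ) ^ (max σ 0) := mul_le_mul_of_nonneg_left hNσ (by positivity)
    calc ((max (|W.c₄| ^ 3) (|W.c₆| ^ 2) : ℚ) : ℝ)
        ≤ ((1729 * max |W.Δ| (|W.c₄| ^ 3) : ℚ) : ℝ) := h1
      _ = 1729 * ((max |W.Δ| (|W.c₄| ^ 3) : ℚ) : ℝ) := by push_cast; ring
      _ ≤ 1729 * (max CH 1 * (N : ℝ) ^ (max σ 0)) := mul_le_mul_of_nonneg_left h2 (by norm_num)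
      _ = 1729 * max CH 1 * (N : ℝ) ^ (max σ 0) := by ring
  -- Silverman: `covol^{-6} ≤ A · max(|c₄|³,|c₆|²) ≤ B · N^{max σ 0}`
  have h6 : ZLattice.covolume L.lattice ^ (-(6 : ℝ)) ≤ B * (N : ℝ) ^ (max σ 0) :=
    calc ZLattice.covolume L.lattice ^ (-(6 : ℝ))
        ≤ A * ((max (|W.c₄| ^ 3) (|W.c₆| ^ 2) : ℚ) : ℝ) := hSil W L hL
      _ ≤ A * (1729 * max CH 1 * (N : ℝ) ^ (max σ 0)) := mul_le_mul_of_nonneg_left hmax hA.le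
      _ = B * (N : ℝ) ^ (max σ 0) := by rw [hB]; ring
  -- logarithms: `-6 log covol ≤ log B + max σ 0 · log N`
  have hlog : -6 * Real.log (ZLattice.covolume L.lattice) ≤ Real.log B + max σ 0 * Real.log N := by
    have hl := Real.log_le_log (Real.rpow_pos_of_pos hcov _) h6
    rw [Real.log_rpow hcov, Real.log_mul hB0.ne' (Real.rpow_pos_of_pos hNpos _).ne',
      Real.log_rpow hNpos] at hl
    linarith
  have : -(1 / 2) * Real.log (ZLattice.covolume L.lattice) =
      (1 / 12) * (-6 * Real.log (ZLattice.covolume L.lattice)) := by ring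
  rw [this]
  have h12 : (1 / 12 : ℝ) * (-6 * Real.log (ZLattice.covolume L.lattice)) ≤
      (1 / 12) * (Real.log B + max σ 0 * Real.log N) :=
    mul_le_mul_of_nonneg_left hlog (by norm_num)
  calc (1 / 12 : ℝ) * (-6 * Real.log (ZLattice.covolume L.lattice))
      ≤ (1 / 12) * (Real.log B + max σ 0 * Real.log N) := h12
    _ = max σ 0 / 12 * Real.log N + Real.log B / 12 := by ring

/-- **Logarithmic Faltings height `→ H`.** If `h(E/ℚ) ≤ a · log N + b` for every semistable globally minimal
elliptic `W/ℚ`, then `max(|Δ_W|, |c₄(W)|³) ≤ C · N^{14 · max a 0}` for all such `W`: with a Néron lattice `Λ`,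
`covol(Λ) = exp(−2h) ≥ exp(−2(a log N + b))`, and Silverman's `max(|Δ|, |c₄|³) ≤ A₁ · covol(Λ)^{−7}` on the
global minimal model. [cite: Silverman1986, Prop. 1.1 and Cor. 2.3] -/
theorem polyHeight_of_faltingsHeight_le_log
    (h : ∃ a b : ℝ, ∀ (W : WeierstrassCurve ℚ) [W.IsElliptic] [W.IsGloballyMinimal]
      [NeZero (W.conductorNorm ℤ)], W.IsSemistable ℤ →
      W.faltingsHeight ≤ a * Real.log (W.conductorNorm ℤ) + b) :
    ∃ σ C : ℝ, ∀ (W : WeierstrassCurve ℚ) [W.IsElliptic] [W.IsGloballyMinimal]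
      [NeZero (W.conductorNorm ℤ)], W.IsSemistable ℤ →
      ((max |W.Δ| (|W.c₄| ^ 3) : ℚ) : ℝ) ≤ C * (W.conductorNorm ℤ : ℝ) ^ σ := by
  obtain ⟨a, b, h⟩ := h
  obtain ⟨A₁, hA₁⟩ := silverman1986_discriminant_c4_covolume_holds 1 one_pos
  refine ⟨14 * max a 0, max A₁ 0 * Real.exp (14 * b), fun W _ _ _ hss ↦ ?_⟩
  set N : ℕ := W.conductorNorm ℤ with hNdef
  have hNpos : (0 : ℝ) < N := by exact_mod_cast Nat.pos_of_ne_zero (NeZero.ne N)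
  have hN1 : (1 : ℝ) ≤ N := by exact_mod_cast Nat.pos_of_ne_zero (NeZero.ne N)
  obtain ⟨L, hL⟩ := exists_isNeronLatticeOf_holds (W.baseChange ℂ)
  have hcov : 0 < ZLattice.covolume L.lattice := ZLattice.covolume_pos _ _
  have hW := h W hss
  rw [W.faltingsHeight_eq_neg_half_log_covolume hL] at hW
  -- `-log covol ≤ 2 (a log N + b)`, hence `covol^{-7} = exp(-7 log covol) ≤ exp(14 (a log N + b))`
  have hlog : -Real.log (ZLattice.covolume L.lattice) ≤ 2 * (a * Real.log N + b) := by linarith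
  have hlogN : 0 ≤ Real.log N := Real.log_nonneg hN1
  have ha : a * Real.log N ≤ max a 0 * Real.log N :=
    mul_le_mul_of_nonneg_right (le_max_left _ _) hlogN
  have key : Real.log (ZLattice.covolume L.lattice) * (-(6 + 1 : ℝ)) ≤
      Real.log N * (14 * max a 0) + 14 * b := by
    have h1 : Real.log (ZLattice.covolume L.lattice) * (-(6 + 1 : ℝ)) =
        7 * (-Real.log (ZLattice.covolume L.lattice)) := by ring
    rw [h1]
    linarith [hlog, ha]
  have h7 : ZLattice.covolume L.lattice ^ (-(6 + 1 : ℝ)) ≤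
      (N : ℝ) ^ (14 * max a 0) * Real.exp (14 * b) := by
    rw [Real.rpow_def_of_pos hcov, Real.rpow_def_of_pos hNpos, ← Real.exp_add]
    exact Real.exp_le_exp.mpr key
  have hS := hA₁ W L hL
  have hpos : 0 ≤ ZLattice.covolume L.lattice ^ (-(6 + 1 : ℝ)) := Real.rpow_nonneg hcov.le _
  have h1 : ((max |W.Δ| (|W.c₄| ^ 3) : ℚ) : ℝ) ≤
      max A₁ 0 * ZLattice.covolume L.lattice ^ (-(6 + 1 : ℝ)) :=
    hS.trans (mul_le_mul_of_nonneg_right (le_max_left _ _) hpos)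
  have h2 : max A₁ 0 * ZLattice.covolume L.lattice ^ (-(6 + 1 : ℝ)) ≤
      max A₁ 0 * ((N : ℝ) ^ (14 * max a 0) * Real.exp (14 * b)) :=
    mul_le_mul_of_nonneg_left h7 (le_max_right _ _)
  have h3 : max A₁ 0 * ((N : ℝ) ^ (14 * max a 0) * Real.exp (14 * b)) =
      max A₁ 0 * Real.exp (14 * b) * (N : ℝ) ^ (14 * max a 0) := by ring
  exact (h1.trans h2).trans h3.le

/-- **The residual of crux B in Faltings-height form (unconditional equivalence).** The polynomial height
conjecture for semistable curves, `max(|Δ_W|, |c₄(W)|³) ≤ C · N_W^σ`, is equivalent to the LOGARITHMIC Faltings-height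
bound `h(E/ℚ) ≤ a · log N_E + b` over the same class of curves (Silverman 1986, Prop. 1.1 and Cor. 2.3). Known in
print is only `h(E) < (1/48 + ε) N log N` (PastenShimura2024 Thm 1.9); the route's item `SemistableHeightPolyBound`
is `h_F ≤ c · N²`. Registered sub-goal of stmt-ABC-2046 (line `Sketch`): name + one-line signature verbatim.
[cite: Silverman1986, Prop. 1.1 and Cor. 2.3] [cite: PastenShimura2024, Thm. 1.9 and §3] -/
theorem faltingsHeight_le_log_iff_polyHeight : (∃ a b : ℝ, ∀ (W : WeierstrassCurve ℚ) [W.IsElliptic] [W.IsGloballyMinimal] [NeZero (W.conductorNorm ℤ)], W.IsSemistable ℤ → W.faltingsHeight ≤ a * Real.log (W.conductorNorm ℤ) + b) ↔ (∃ σ C : ℝ, ∀ (W : WeierstrassCurve ℚ) [W.IsElliptic] [W.IsGloballyMinimal] [NeZero (W.conductorNorm ℤ)], W.IsSemistable ℤ → ((max |W.Δ| (|W.c₄| ^ 3) : ℚ) : ℝ) ≤ C * (W.conductorNorm ℤ : ℝ) ^ σ) :=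
  ⟨polyHeight_of_faltingsHeight_le_log, faltingsHeight_le_log_of_polyHeight⟩

/-- **`H →` logarithmic STABLE Faltings height** (the quantity of the route's lever `EllipticGluingPrimeBound` and
of `SemistableHeightPolyBound`): `h_F(E) ≤ a · log N_E + b` for every semistable globally minimal elliptic `W/ℚ`,
from `h_F ≤ h(E/ℚ)` (`stableFaltingsHeight_le_faltingsHeight_rat`). [cite: Silverman1986, §2 eq. (9)] -/
theorem stableFaltingsHeight_le_log_of_polyHeight
    (hH : ∃ σ C : ℝ, ∀ (W : WeierstrassCurve ℚ) [W.IsElliptic] [W.IsGloballyMinimal]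
      [NeZero (W.conductorNorm ℤ)], W.IsSemistable ℤ →
      ((max |W.Δ| (|W.c₄| ^ 3) : ℚ) : ℝ) ≤ C * (W.conductorNorm ℤ : ℝ) ^ σ) :
    ∃ a b : ℝ, ∀ (W : WeierstrassCurve ℚ) [W.IsElliptic] [W.IsGloballyMinimal]
      [NeZero (W.conductorNorm ℤ)], W.IsSemistable ℤ →
      W.stableFaltingsHeight ≤ a * Real.log (W.conductorNorm ℤ) + b := by
  obtain ⟨a, b, h⟩ := faltingsHeight_le_log_of_polyHeight hH
  exact ⟨a, b, fun W _ _ _ hss ↦ (stableFaltingsHeight_le_faltingsHeight_rat W).trans (h W hss)⟩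

/-- **Crux B in Faltings-height form**: granted crux A, crux B yields the logarithmic Faltings-height bound for
semistable curves (composition with the unconditional `polyHeight_of_polyDegreeOfBoundedPrimes : B → A → H`).
[cite: MurtyCongruencePrimes1999, Thm. 1 (i) and §2] -/
theorem faltingsHeight_le_log_of_polyDegreeOfBoundedPrimes (hB : PolyDegreeOfBoundedPrimes)
    (hA : DegreePrimesPolyBounded) :
    ∃ a b : ℝ, ∀ (W : WeierstrassCurve ℚ) [W.IsElliptic] [W.IsGloballyMinimal]
      [NeZero (W.conductorNorm ℤ)], W.IsSemistable ℤ →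
      W.faltingsHeight ≤ a * Real.log (W.conductorNorm ℤ) + b :=
  faltingsHeight_le_log_of_polyHeight (polyHeight_of_polyDegreeOfBoundedPrimes hB hA)

end Summit.ABC.ABC.Theorems

end
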